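import Summits.ABC.ABC.Theorems.CuspFieldPencilGoldenFromNFPencil
import Summits.ABC.ABC.Theorems.YuMatveevShapeRatCloses
import Literature.Barriers.ABC.BakerMethodBoundsThreeRoutesProofs
import Literature.Barriers.ABC.BakerMethodBoundsWeakArchProofs
import Literature.Barriers.ABC.BakerMethodBoundsStewartYuProofs
import Literature.NumberTheory.DiophantineGeometry.AbcTwoAdicValuationProofs
import HarnessLib

/-!
# STUB-IDEAS sketch · `stub_splitCuspTriple` · ideator k2 (GEN 3) — FAMILY 2 (RESHAPE) + FAMILY 1 tree-match

Crux `GoldenCuspShadow` (stmt-ABC-26026), route `CuspFieldPencil`, skeleton sha a4ca286a….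
Elaboration-only sketch: every `sorry` below is a PROPOSED HELPER LEMMA (sizes in the docstrings);
the sorry-free declarations (`tU`, `tW`, `prod_symm`, `natAbs_radical_cast`, `preBound_all`,
`cuspMinRadBound_of_pasten`, `cuspMinRadBound_holds`, `stubSplit_holds`, `goldenCuspShadow_holds`)
certify that the tree inputs compose as claimed — in particular that the whole line is
UNCONDITIONAL: its only external input is the KERNEL THEOREM
`Summit.ABC.ABC.Theorems.approximationBound_rat_holds : ∃ K ≥ 1, PastenApproximationBound K`
(route YuMatveevShapeRat, closed·proved 2026-08-27).

THE RESHAPE (GEN 3 delta over k2-g2 / k1-g2).  Keep the two auxiliary rational identities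
  `T_u :  w² + Q = u(u − 11w)`,   `T_w :  u² − Q = w(11u + w)`,   `Q = u² − 11uw − w²`,
but feed the RATIOS `ξ_u = −Q/w²` (so `1 − ξ_u = u(u−11w)/w²`) and `ξ_w = Q/u²`
(so `1 − ξ_w = w(11u+w)/u²`) DIRECTLY to the tree's parametric two-place approximation bound
`Pasten.approx_div` (for `ξ = ζ·x/y`, `x, y` coprime naturals, `xy > 1`, `ζ = ±1`, `ξ ≠ 1`;
threshold `N = 0`):
* p-adic clause at the primes `p ∣ u`: `ν_p(u) ≤ ord_p(1 − ξ_u)` and the bound only involves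
  `Θ₁ = theta K |Q| w² 0` — the primes of `u − 11w` (size `~H`) NEVER enter;
* archimedean clause for `ξ_w`: `2 log|u| − log|w| − log|11u+w| < Θ₂ · Y`, `Θ₂ = theta K |Q| u² 0`
  — transfers `log|u|` to `log|w| + log 12 + Θ₂ Y` in the regime `|w| ≤ |u|`.
No `IsABCTriple` normalisation / sign-case lemma (k1-g2 `exists_abcTriple_of_int_sum`, k2-g2 H2),
no Matveev named fact (k2-g2's only conditional input): `approx_div` already carries `ζ = ±1` and
arbitrary coprime naturals.  Output: `CuspMinRadBound` (log H ≪_ε R^ε · min(rad u, rad w)), which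
gives the STUB (exponent to spare) and the CRUX (`min ≤ R^{1/2}`).
-/

set_option linter.dupNamespace false

open Finset Real Height
open Literature.NumberTheory.DiophantineGeometry
open Literature.NumberTheory.DiophantineGeometry.Dioph
open Literature.NumberTheory.DiophantineGeometry.Pasten
open Literature.Barriers.ABC
open Summit.ABC.ABC.Theorems

namespace Summit.ABC.ABC.Cruxes.GoldenCuspShadow.SplitK2G3

/-! ## 0 · The stub (verbatim), the reshape target, the two reductions -/

/-- The registered stub signature `stub_splitCuspTriple`, verbatim. -/
def StubSplit : Prop :=
  ∀ ε : ℝ, 0 < ε → ∃ κ : ℝ, ∀ u w : ℤ, IsCoprime u w → u * w * (u ^ 2 - 11 * u * w - w ^ 2) ≠ 0 → Real.log (max (|(u : ℝ)|) (|(w : ℝ)|)) ≤ κ * (((UniqueFactorizationMonoid.radical (u * w * (u ^ 2 - 11 * u * w - w ^ 2))).natAbs : ℕ) : ℝ) ^ (ε : ℝ) * (((((UniqueFactorizationMonoid.radical u).natAbs : ℕ) : ℝ) * (((UniqueFactorizationMonoid.radical w).natAbs : ℕ) : ℝ)) ^ (2 / 3 : ℝ) * (((UniqueFactorizationMonoid.radical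 (u ^ 2 - 11 * u * w - w ^ 2)).natAbs : ℕ) : ℝ) ^ (1 / 3 : ℝ))

/-- RESHAPE TARGET `CuspMinRadBound` (same text as k2-g2): `log max(|u|,|w|) ≤ κ_ε · rad(uwQ)^ε · min(rad u, rad w)`. -/
def CuspMinRadBound : Prop :=
  ∀ ε : ℝ, 0 < ε → ∃ κ : ℝ, ∀ u w : ℤ, IsCoprime u w → u * w * (u ^ 2 - 11 * u * w - w ^ 2) ≠ 0 →
    Real.log (max (|(u : ℝ)|) (|(w : ℝ)|)) ≤
      κ * (((UniqueFactorizationMonoid.radical (u * w * (u ^ 2 - 11 * u * w - w ^ 2))).natAbs : ℕ) : ℝ) ^ (ε : ℝ) *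
        min ((((UniqueFactorizationMonoid.radical u).natAbs : ℕ) : ℝ))
            ((((UniqueFactorizationMonoid.radical w).natAbs : ℕ) : ℝ))

/-- R1 (S, real arithmetic): reshape target ⇒ stub.  Radicals are `≥ 1` (`Int.radical_pos`);
`min x y ≤ (x*y)^{1/2} ≤ (x*y)^{2/3}` for `x, y ≥ 1`; `z^{1/3} ≥ 1`; same `κ`. -/
theorem stubSplit_of_cuspMinRadBound : CuspMinRadBound → StubSplit := by
  sorry

/-- R2 (S): reshape target ⇒ CRUX: `min(rad u, rad w) ≤ (rad u · rad w)^{1/2} ≤ R^{1/2}` by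
`GoldenFromNFPencil.natAbs_radical_prod`; exponents `ε + 1/2`. -/
theorem goldenCuspShadow_of_cuspMinRadBound :
    CuspMinRadBound → Summit.ABC.ABC.Theses.CuspFieldPencil.GoldenCuspShadow := by
  sorry

/-! ## 1 · Objects (abbreviations only; no new notions) -/

/-- `Q(u,w) = u² − 11uw − w²` (the norm form of the cusps of `X₁(5)`). -/
abbrev Q (u w : ℤ) : ℤ := u ^ 2 - 11 * u * w - w ^ 2

/-- `H(u,w) = max(|u|,|w|)` as a real number. -/
abbrev H (u w : ℤ) : ℝ := max |(u : ℝ)| |(w : ℝ)|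

/-- `sign z` as a rational number (`= ±1` for `z ≠ 0`). -/
abbrev sgn (z : ℤ) : ℚ := ((Int.sign z : ℤ) : ℚ)

/-- `ξ_u = −Q/w²`, written in the `approx_div` shape `ζ · (x : ℚ)/y` with `x = |Q|`, `y = |w|²`, `ζ = −sign Q`. -/
abbrev xiU (u w : ℤ) : ℚ := (-sgn (Q u w)) * ((((Q u w).natAbs : ℕ) : ℚ) / ((w.natAbs ^ 2 : ℕ) : ℚ))

/-- `ξ_w = Q/u²`, in the `approx_div` shape with `x = |Q|`, `y = |u|²`, `ζ = sign Q`. -/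
abbrev xiW (u w : ℤ) : ℚ := (sgn (Q u w)) * ((((Q u w).natAbs : ℕ) : ℚ) / ((u.natAbs ^ 2 : ℕ) : ℚ))

/-- The pre-self-improvement bound at `(u, w)` with constants `C, δ`:
`log H ≤ C · rad(uwQ)^δ · min(rad u, rad w) · log max(e, 2 log H)`. -/
def PreBoundAt (C δ : ℝ) (u w : ℤ) : Prop :=
  Real.log (H u w) ≤
    C * (((UniqueFactorizationMonoid.radical (u * w * Q u w)).natAbs : ℕ) : ℝ) ^ δ *
      min ((((UniqueFactorizationMonoid.radical u).natAbs : ℕ) : ℝ))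
          ((((UniqueFactorizationMonoid.radical w).natAbs : ℕ) : ℝ)) *
      Real.log (max (Real.exp 1) (2 * Real.log (H u w)))

/-! ## 2 · Algebra (XS, proved here) -/

/-- `T_u : w² + Q = u(u − 11w)`. -/
theorem tU (u w : ℤ) : w ^ 2 + Q u w = u * (u - 11 * w) := by
  simp only [Q]; ring

/-- `T_w : u² − Q = w(11u + w)`. -/
theorem tW (u w : ℤ) : u ^ 2 - Q u w = w * (11 * u + w) := by
  simp only [Q]; ring

/-- The symmetry `(u, w) ↦ (w, −u)` negates `Q` … -/
theorem Q_symm (u w : ℤ) : Q w (-u) = -Q u w := by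
  simp only [Q]; ring

/-- … and FIXES the product `u·w·Q` (so `rad(uwQ)` is literally unchanged). -/
theorem prod_symm (u w : ℤ) : w * (-u) * Q w (-u) = u * w * Q u w := by
  simp only [Q]; ring

/-- H0 (XS, cast bookkeeping): `(radical z).natAbs`, as a real, is the product of the rational primes of `z`. -/
theorem natAbs_radical_cast (z : ℤ) :
    (((UniqueFactorizationMonoid.radical z).natAbs : ℕ) : ℝ) = ∏ p ∈ z.natAbs.primeFactors, (p : ℝ) := by
  rw [← Int.radical_natAbs_eq_radical, Int.natAbs_natCast, Nat.radical_eq_prod_primeFactors, Nat.cast_prod]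

/-- A1 (XS): `ζ = ±1` for the two signs (`Int.sign_eq_one_of_pos`, `Int.sign_eq_neg_one_of_neg`). -/
theorem sgn_cases {z : ℤ} (hz : z ≠ 0) : (sgn z = 1 ∨ sgn z = -1) ∧ (-sgn z = 1 ∨ -sgn z = -1) := by
  sorry

/-- A2 (XS): `1 − ξ_u = u(u − 11w)/w²` (`Int.sign_mul_natAbs`, `Int.natCast_natAbs`, `sq_abs`, `tU`). -/
theorem one_sub_xiU {u w : ℤ} (hw : w ≠ 0) :
    1 - xiU u w = ((u : ℚ) * (u - 11 * w)) / (w : ℚ) ^ 2 := by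
  sorry

/-- A3 (XS): `1 − ξ_w = w(11u + w)/u²`. -/
theorem one_sub_xiW {u w : ℤ} (hu : u ≠ 0) :
    1 - xiW u w = ((w : ℚ) * (11 * u + w)) / (u : ℚ) ^ 2 := by
  sorry

/-! ## 3 · Escapes and the `approx_div` side conditions (XS–S) -/

/-- E1 (XS): the `T_u`-escape `u = 11w` forces `(u, w) = ±(11, 1)`, so `H = 11`. -/
theorem escape_u {u w : ℤ} (h : IsCoprime u w) (he : u - 11 * w = 0) : H u w = 11 := by
  sorry

/-- E2 (XS): in the regime `|w| ≤ |u|`, `u ≠ 0`, the `T_w`-escape `11u + w = 0` cannot occur. -/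
theorem no_escape_w {u w : ℤ} (hu : u ≠ 0) (hle : |w| ≤ |u|) : 11 * u + w ≠ 0 := by
  sorry

/-- E3 (S−): `x·y > 1` for `T_u`: `|Q|·w² = 1` would force `u(u − 11w) = w² + Q ∈ {0, 2}`, impossible
(`u ∣ 2` case check). -/
theorem one_lt_xy_u {u w : ℤ} (h : IsCoprime u w) (h0 : u * w * Q u w ≠ 0) (hne : u - 11 * w ≠ 0) :
    1 < (Q u w).natAbs * w.natAbs ^ 2 := by
  sorry

/-- E4 (S−): `x·y > 1` for `T_w` (symmetric to E3). -/
theorem one_lt_xy_w {u w : ℤ} (h : IsCoprime u w) (h0 : u * w * Q u w ≠ 0) (hne : 11 * u + w ≠ 0) :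
    1 < (Q u w).natAbs * u.natAbs ^ 2 := by
  sorry

/-- E5 (XS): `gcd(|Q|, w²) = 1 = gcd(|Q|, u²)` (`GoldenFromNFPencil.isCoprime_quadForm_left/right`,
`Int.isCoprime_iff_gcd_eq_one`, `Nat.Coprime.pow_right`). -/
theorem coprime_xy {u w : ℤ} (h : IsCoprime u w) :
    ((Q u w).natAbs).Coprime (w.natAbs ^ 2) ∧ ((Q u w).natAbs).Coprime (u.natAbs ^ 2) := by
  sorry

/-- E6 (XS): `ξ_u ≠ 1` off the `T_u`-escape, `ξ_w ≠ 1` off the `T_w`-escape (by A2/A3). -/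
theorem xi_ne_one {u w : ℤ} (h0 : u * w * Q u w ≠ 0) :
    (u - 11 * w ≠ 0 → xiU u w ≠ 1) ∧ (11 * u + w ≠ 0 → xiW u w ≠ 1) := by
  sorry

/-! ## 4 · p-adic side: the DIVISOR-member bound at the primes of `u` (from `T_u`) -/

/-- P1 (S): for `p ∣ u`: `ν_p(u) ≤ ν_p(u) + ν_p(u − 11w) = ord_p(1 − ξ_u)` (`p ∤ w` by coprimality;
`padicValRat` of `u(u−11w)/w²`, `Nat.factorization_def`, `padicValInt`). -/
theorem factorization_le_padicValRat_xiU {u w : ℤ} (h : IsCoprime u w) (h0 : u * w * Q u w ≠ 0)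
    (hne : u - 11 * w ≠ 0) {p : ℕ} (hp : p ∈ u.natAbs.primeFactors) :
    ((u.natAbs.factorization p : ℕ) : ℝ) ≤ ((padicValRat p (1 - xiU u w) : ℤ) : ℝ) := by
  sorry

/-- P2 (S, generic bookkeeping): `log|u| = ∑_{p∣u} ν_p(u) log p` (`log_eq_sum_factorization_mul_log`)
summed against a prime-by-prime bound `ord_p(1−ξ)·log p < Θ·F(p)`. -/
theorem log_natAbs_le_of_padic {u : ℤ} (hu : u ≠ 0) {ξ : ℚ} {Θ : ℝ} {F : ℕ → ℝ}
    (hval : ∀ p ∈ u.natAbs.primeFactors, ((u.natAbs.factorization p : ℕ) : ℝ) ≤ ((padicValRat p (1 - ξ) : ℤ) : ℝ))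
    (hbd : ∀ p : ℕ, p.Prime → ((padicValRat p (1 - ξ) : ℤ) : ℝ) * Real.log p < Θ * F p) :
    Real.log |(u : ℝ)| ≤ Θ * ∑ p ∈ u.natAbs.primeFactors, F p := by
  sorry

/-- P3 (S, numerics at one prime): `max(e, p·h) ≤ p · max(e, h)` for `p ≥ 2`, `h ≥ 0`, then
`ThreeRoutes.div_log_mul_add_le` with `Y = log max(e, h) ≥ 1`. -/
theorem numerics_prime {p : ℕ} (hp : p.Prime) {h : ℝ} (hh : 0 ≤ h) :
    (p : ℝ) / Real.log p * Real.log (max (Real.exp 1) (p * h)) ≤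
      3 * p * Real.log (max (Real.exp 1) h) := by
  sorry

/-- P4 (M−, the composition): `approx_div hK hP` (p-adic clause, `x = |Q|`, `y = |w|²`, `ζ = −sign Q`,
`N = 0`; side conditions E3, E5, A1, E6) + P1 + P2 + P3 (`theta_nonneg` for monotonicity):
`log|u| ≤ 3 · Θ₁ · log max(e, h(ξ_u)) · ∑_{p ∣ u} p`, `Θ₁ = theta K |Q| w² 0`.
The primes of `u − 11w` never enter. -/
theorem padic_member_u {K : ℝ} (hK : 1 ≤ K) (hP : PastenApproximationBound K) {u w : ℤ}
    (h : IsCoprime u w) (h0 : u * w * Q u w ≠ 0) (hne : u - 11 * w ≠ 0) :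
    Real.log |(u : ℝ)| ≤
      3 * theta K (Q u w).natAbs (w.natAbs ^ 2) 0 * Real.log (max (Real.exp 1) (logHeight₁ (xiU u w))) *
        ∑ p ∈ u.natAbs.primeFactors, (p : ℝ) := by
  sorry

/-! ## 5 · Archimedean side: the transfer inequality (from `T_w`) -/

/-- W1 (S): `approx_div hK hP` (archimedean clause, `x = |Q|`, `y = |u|²`, `ζ = sign Q`, `N = 0`;
side conditions E4, E5, A1, E6) + A3: `−log|1 − ξ_w| = 2 log|u| − log|w| − log|11u + w|`
(`Rat.cast_div`, `Real.log_div`, `Real.log_mul`, `Real.log_pow`). -/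
theorem arch_member_w {K : ℝ} (hK : 1 ≤ K) (hP : PastenApproximationBound K) {u w : ℤ}
    (h : IsCoprime u w) (h0 : u * w * Q u w ≠ 0) (hne : 11 * u + w ≠ 0) :
    2 * Real.log |(u : ℝ)| - Real.log |(w : ℝ)| - Real.log |((11 * u + w : ℤ) : ℝ)| <
      theta K (Q u w).natAbs (u.natAbs ^ 2) 0 * Real.log (max (Real.exp 1) (logHeight₁ (xiW u w))) := by
  sorry

/-- W2 (XS): `log|11u + w| ≤ log 12 + log H`. -/
theorem log_abs_lin_le {u w : ℤ} (h0 : u * w ≠ 0) :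
    Real.log |((11 * u + w : ℤ) : ℝ)| ≤ Real.log 12 + Real.log (H u w) := by
  sorry

/-! ## 6 · Heights and the common `Y` -/

/-- Y1 (S): `h(ξ_u), h(ξ_w) ≤ log(13·H⁴)` (`Pasten.logHeight₁_sign_mul_div_le`: `h(±x/y) ≤ log x + log y`;
`|Q| ≤ 13H²`, `u², w² ≤ H²`). -/
theorem logHeight₁_xi_le {u w : ℤ} (h0 : u * w * Q u w ≠ 0) :
    logHeight₁ (xiU u w) ≤ Real.log (13 * H u w ^ 4) ∧ logHeight₁ (xiW u w) ≤ Real.log (13 * H u w ^ 4) := by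
  sorry

/-- Y2 (S, numerics checked by hand: at `2 log H ≤ e` LHS `≤ log 8 < 3`; beyond, `log 13 + 4y ≤ (2y)³`):
`log max(e, h) ≤ 3 · log max(e, 2 log H)` whenever `h ≤ log(13 H⁴)`, `H ≥ 1`. -/
theorem logmax_le_three {Hr h : ℝ} (hH : 1 ≤ Hr) (hh : h ≤ Real.log (13 * Hr ^ 4)) :
    Real.log (max (Real.exp 1) h) ≤ 3 * Real.log (max (Real.exp 1) (2 * Real.log Hr)) := by
  sorry

/-! ## 7 · Absorption `Θ ≤ C_δ · rad(uwQ)^δ` -/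

/-- J1 (S): both `Θ`'s are `≤ K · ∏_{q ∣ uwQ} 2K·max(1, log q)` (`WeakArch.theta_zero_le_mul_prod` with
`n = |uwQ|·|w|` resp. `|uwQ|·|u|`, whose prime factors are those of `|uwQ|`; or `theta_zero_eq` +
`Finset.prod_le_prod_of_subset_of_one_le`). -/
theorem theta_le_J {K : ℝ} (hK : 1 ≤ K) {u w : ℤ} (h : IsCoprime u w) (h0 : u * w * Q u w ≠ 0) :
    theta K (Q u w).natAbs (w.natAbs ^ 2) 0 ≤
        K * ∏ q ∈ (u * w * Q u w).natAbs.primeFactors, 2 * K * max 1 (Real.log q) ∧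
      theta K (Q u w).natAbs (u.natAbs ^ 2) 0 ≤
        K * ∏ q ∈ (u * w * Q u w).natAbs.primeFactors, 2 * K * max 1 (Real.log q) := by
  sorry

/-- J2 (S): `K · ∏_{q ∣ n} 2K·max(1, log q) ≤ C_{K,δ} · (∏_{q ∣ n} q)^δ`
(`prod_primeFactors_le_pow_mul_rpow` with `g q = 2K max(1, log q) ≤ q^δ` for `q ≥ T(K,δ)` by
`Real.log_le_rpow_div`). -/
theorem J_le_rad_rpow {K : ℝ} (hK : 1 ≤ K) {δ : ℝ} (hδ : 0 < δ) :
    ∃ C : ℝ, 1 ≤ C ∧ ∀ n : ℕ,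
      K * ∏ q ∈ n.primeFactors, 2 * K * max 1 (Real.log q) ≤ C * (∏ q ∈ n.primeFactors, (q : ℝ)) ^ δ := by
  sorry

/-- J3 (XS): `∑_{p ∣ n} p ≤ ∏_{p ∣ n} p = rad n` (all primes `≥ 2`; induction on the finset). -/
theorem sum_primeFactors_le_prod (n : ℕ) :
    ∑ p ∈ n.primeFactors, (p : ℝ) ≤ ∏ p ∈ n.primeFactors, (p : ℝ) := by
  sorry

/-! ## 8 · The regime endgame, the symmetry, self-improvement -/

/-- M1 (M, the heart): in the regime `|w| ≤ |u|` (so `H = |u|`): off the escape `u = 11w` (E1: `H = 11`,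
absorbed since every factor on the right is `≥ 1`), P4 gives `log H ≤ 3Θ₁Y·rad u`, and W1 + W2 + P4
applied to `(w, −u)` (coprime, same product by `prod_symm`, `T_w`-escape excluded by E2) give
`log H ≤ log|w| + log 12 + Θ₂Y ≤ 7·G·Y·rad w`; with Y1/Y2 (`Y = 3 log max(e, 2 log H)`), J1–J3, H0:
`log H ≤ 21·C_{K,δ}·R^δ · min(rad u, rad w) · log max(e, 2 log H)`. -/
theorem preBound_regime {K : ℝ} (hK : 1 ≤ K) (hP : PastenApproximationBound K) {δ : ℝ} (hδ : 0 < δ) :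
    ∃ C : ℝ, ∀ u w : ℤ, IsCoprime u w → u * w * Q u w ≠ 0 → |w| ≤ |u| → PreBoundAt C δ u w := by
  sorry

/-- M2 (XS): `PreBoundAt` is invariant under `(u, w) ↦ (w, −u)` (`prod_symm`; `rad(−u) = rad u` via
`Int.radical_natAbs_eq_radical`; `max_comm`, `min_comm`, `abs_neg`). -/
theorem preBoundAt_symm (C δ : ℝ) (u w : ℤ) : PreBoundAt C δ w (-u) ↔ PreBoundAt C δ u w := by
  sorry

/-- M3 (proved): WLOG `|w| ≤ |u|`. -/
theorem preBound_all {K : ℝ} (hK : 1 ≤ K) (hP : PastenApproximationBound K) {δ : ℝ} (hδ : 0 < δ) :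
    ∃ C : ℝ, ∀ u w : ℤ, IsCoprime u w → u * w * Q u w ≠ 0 → PreBoundAt C δ u w := by
  obtain ⟨C, hC⟩ := preBound_regime hK hP hδ
  refine ⟨C, fun u w h h0 => ?_⟩
  rcases le_or_gt |w| |u| with hle | hlt
  · exact hC u w h h0 hle
  · have h' : IsCoprime w (-u) := h.symm.neg_right
    have h0' : w * (-u) * Q w (-u) ≠ 0 := by rw [prod_symm]; exact h0
    have hle' : |(-u)| ≤ |w| := by rw [abs_neg]; exact hlt.le
    exact (preBoundAt_symm C δ u w).1 (hC w (-u) h' h0' hle')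

/-- M4 (M−): self-improvement and exponent bookkeeping: with `M = max 1 (C R^δ min)`,
`StewartYu.le_of_le_mul_log_max` gives `log H ≤ 2M log(4M)`; `log(4M) ≤ (4M)^η/η`
(`Real.log_le_rpow_div`); `min^{1+η} ≤ min · R^η` (`min ≤ rad u ≤ R` by `natAbs_radical_prod`);
take `δ = η = min(ε,1)/3`. -/
theorem cuspMinRadBound_of_preBound
    (hpre : ∀ δ : ℝ, 0 < δ → ∃ C : ℝ, ∀ u w : ℤ, IsCoprime u w → u * w * Q u w ≠ 0 → PreBoundAt C δ u w) :
    CuspMinRadBound := by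
  sorry

/-! ## 9 · Assembly (sorry-free): helper ⇒ reshape target ⇒ stub and crux, UNCONDITIONALLY -/

/-- The reshape target from any `K ≥ 1` with `PastenApproximationBound K`. -/
theorem cuspMinRadBound_of_pasten {K : ℝ} (hK : 1 ≤ K) (hP : PastenApproximationBound K) :
    CuspMinRadBound :=
  cuspMinRadBound_of_preBound fun _ hδ => preBound_all hK hP hδ

/-- `CuspMinRadBound` holds outright: the input `∃ K ≥ 1, PastenApproximationBound K` is the kernel theorem
`approximationBound_rat_holds` (route YuMatveevShapeRat). -/
theorem cuspMinRadBound_holds : CuspMinRadBound := by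
  obtain ⟨K, hK, hP⟩ := approximationBound_rat_holds
  exact cuspMinRadBound_of_pasten hK hP

/-- The stub, modulo the sorried helpers only. -/
theorem stubSplit_holds : StubSplit :=
  stubSplit_of_cuspMinRadBound cuspMinRadBound_holds

/-- The crux `GoldenCuspShadow` by name, modulo the sorried helpers only (so `NFPencilBound` and
`stub_conjugateCuspTriple` become unnecessary once the helpers close). -/
theorem goldenCuspShadow_holds : Summit.ABC.ABC.Theses.CuspFieldPencil.GoldenCuspShadow :=
  goldenCuspShadow_of_cuspMinRadBound cuspMinRadBound_holds

end Summit.ABC.ABC.Cruxes.GoldenCuspShadow.SplitK2G3
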